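import Mathlib
import Literature.MathematicalPhysics.QuantumLattice.FermiRG.Salmhofer1998PropagatorBoundsProof
import HarnessLib

/-!
# Salmhofer 1998, §5.4: the step function `ω_β` ((5.13), (5.15)) and the scalar part of Lemma 4 — PROOFS

M. Salmhofer, *Continuous renormalization for fermions and Fermi liquid theory*, Commun. Math. Phys.
**194** (1998) 249–295 = arXiv:cond-mat/9706188 [Salmhofer1998], §5.4 (render `paper:arxiv-cond-mat_9706188`
p.19 L86–175, p.20 L1–34; locators `p.N Ln` = chunk `pNNNN.txt` line `n` of the materialised arXiv TeX).

Theorem-only companion of the FROZEN statement file `Salmhofer1998Sec5.lean` (t7, gate-hubbard-kl wave):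
the objects `omegaStep` (5.13), `covC` (5.17), `covCDot`, `cutoffCovInf` typed there are given their printed
elementary properties, PROVED (no new definition, no named fact, net debt `0`):

* **(5.13) spelled out** (`omegaStep_eq`): `ω_β(p₀) = (π/β)(2n+1)` for `p₀ ∈ (2πn/β, 2π(n+1)/β]`;
  **(5.15)** (`abs_omegaStep_sub_le`, `pi_div_le_abs_omegaStep`): `|ω_β(p₀) - p₀| ≤ π/β`, `|ω_β(p₀)| ≥ π/β`;
  and "`|ω_β(p₀)| ≥ p₀/2`" (`abs_div_two_le_abs_omegaStep`), p.19 L107–113.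
* **"By cCdef, `𝒞̇_t(x,y) = -(2/ε_t²)(ix + y) χ₁'((x² + y²)/ε_t²)`"** (`covCDot_eq`; p.20 L4–6 and L80–82), from
  the chain rule of the companion `Salmhofer1998PropagatorBoundsProof.lean` (`hasDerivAt_cutoffComp`) and
  `(x² + y²)/(ix - y) = -(ix + y)`.
* **Lemma 4 (p.19 L132–145), the parts that involve no `𝐩`-derivative and no Jacobian `J`**: `D̂_t(p) =
  𝒞_t(ω_β(p₀), E(𝐩))` is bounded (`norm_cutoffCovInf_le`: `≤ β/π`, from `|ω_β| ≥ π/β`), `C^∞` in `t`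
  (`contDiff_cutoffCovInf`), vanishes for `t > log(βε₀/π)` (`cutoffCovInf_eq_zero_of_log_lt`: "for `C_t(p)`
  to be nonzero, `|ω_β(p₀)| ≤ ε_t` must hold", p.20 L2–3), and the `α = 0` case of (5.18) with **`B₀ = 4`**:
  `|Ḋ̂_t(p)| ≤ 4ε_t⁻¹ 1(|iω_β(p₀) - E(𝐩)| ≤ ε_t) ≤ 4ε_t⁻¹ 1(|ω_β(p₀)| ≤ ε_t) 1(|E(𝐩)| ≤ ε_t)`
  (`norm_covCDot_le`, `norm_deriv_cutoffCovInf_le`, `shell_indicator_le`; "and `‖χ₁'‖_∞ ≤ 2`, … Thus `B₀ = 4`",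
  p.20 L4–9).

NOT covered (honestly out of scope here): the `𝐩`-derivative bounds of (5.18) for `α ≠ 0` (constants
`B_α`, `E ∈ C^{k₀}`), the `p₀`-integral identity (5.14) and the integrated bounds (5.19)–(5.21) (they need
(5.14) and the angular Jacobian mass `J₁` of the low-energy chart — the statement file records (5.21) as the
predicate `Display521`), and Lemma 5 (licence F-086).  Lemma 4 as a whole (licence F-085) was never typed as
a fact; nothing here asserts it.

The three `ω_β` lemmas were prepared by t7 g2 for a post-wave revision of the statement file and are filed
here instead, so that the frozen file stays untouched.  No `instance`, no `notation`, no sorry/axiom;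
nothing about the Hubbard model is asserted or denied.
-/

noncomputable section

open Filter
open scoped Topology

namespace Literature.MathematicalPhysics.QuantumLattice.FermiRG

namespace Salmhofer1998

variable {d : ℕ}

/-! ### (5.13) and (5.15): the step function `ω_β` -/

/-- **(5.13) spelled out**: for `β > 0` and `p₀ ∈ (2πn/β, 2π(n+1)/β]`, `ω_β(p₀) = (π/β)(2n+1)`
(the printed case definition of the step function `ω_β`). [cite: Salmhofer1998, §5.4 (5.13) (p.19 L93–98)] -/
theorem omegaStep_eq {β p₀ : ℝ} (hβ : 0 < β) {n : ℤ}
    (h1 : 2 * Real.pi * n / β < p₀) (h2 : p₀ ≤ 2 * Real.pi * (n + 1) / β) :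
    omegaStep β p₀ = matsFreq β n := by
  unfold omegaStep
  congr 1
  have hπ : 0 < 2 * Real.pi := by positivity
  have hceil : ⌈β * p₀ / (2 * Real.pi)⌉ = n + 1 := by
    rw [Int.ceil_eq_iff]
    constructor
    · push_cast
      rw [add_sub_cancel_right, lt_div_iff₀ hπ]
      rw [div_lt_iff₀ hβ] at h1
      linarith
    · push_cast
      rw [div_le_iff₀ hπ]
      rw [le_div_iff₀ hβ] at h2
      linarith
  rw [hceil]; ring

/-- **(5.15), first half**: `|ω_β(p₀) − p₀| ≤ π/β` for `β > 0` ("`sup_{p₀} |ω_β(p₀) - p₀| = π/β`"; the bound).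
[cite: Salmhofer1998, §5.4 (5.15) (p.19 L107–113)] -/
theorem abs_omegaStep_sub_le {β : ℝ} (hβ : 0 < β) (p₀ : ℝ) :
    |omegaStep β p₀ - p₀| ≤ Real.pi / β := by
  unfold omegaStep matsFreq
  set m : ℤ := ⌈β * p₀ / (2 * Real.pi)⌉ with hm
  have hπ : 0 < Real.pi := Real.pi_pos
  have h1 : (m : ℝ) < β * p₀ / (2 * Real.pi) + 1 := Int.ceil_lt_add_one _
  have h2 : β * p₀ / (2 * Real.pi) ≤ (m : ℝ) := Int.le_ceil _
  have hx : p₀ = 2 * Real.pi / β * (β * p₀ / (2 * Real.pi)) := by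
    field_simp
  have hrw : Real.pi / β * (2 * ((m : ℝ) - 1) + 1) - 2 * Real.pi / β * (β * p₀ / (2 * Real.pi)) =
      Real.pi / β * (2 * ((m : ℝ) - β * p₀ / (2 * Real.pi)) - 1) := by ring
  have hpos : 0 < Real.pi / β := div_pos hπ hβ
  rw [abs_le]
  constructor
  · push_cast
    rw [hx, hrw]
    nlinarith
  · push_cast
    rw [hx, hrw]
    nlinarith

/-- **(5.15), second half**: `|ω_β(p₀)| ≥ π/β` for `β > 0` ("`inf_{p₀} |ω_β(p₀)| = π/β`"; the bound: at
positive temperature the values of `ω_β` stay away from `0`). [cite: Salmhofer1998, §5.4 (5.15) (p.19 L107–113)] -/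
theorem pi_div_le_abs_omegaStep {β : ℝ} (hβ : 0 < β) (p₀ : ℝ) :
    Real.pi / β ≤ |omegaStep β p₀| := by
  unfold omegaStep matsFreq
  set m : ℤ := ⌈β * p₀ / (2 * Real.pi)⌉ with hm
  have hπ : 0 < Real.pi := Real.pi_pos
  have hodd : (1 : ℝ) ≤ |(2 * ((m : ℝ) - 1) + 1)| := by
    have : (2 * ((m : ℝ) - 1) + 1) = ((2 * (m - 1) + 1 : ℤ) : ℝ) := by push_cast; ring
    rw [this, ← Int.cast_abs, ← Int.cast_one, Int.cast_le]
    have hne : (2 * (m - 1) + 1 : ℤ) ≠ 0 := by omega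
    exact Int.one_le_abs hne
  push_cast
  rw [abs_mul, abs_of_pos (div_pos hπ hβ)]
  have hpos : 0 < Real.pi / β := div_pos hπ hβ
  nlinarith

/-- "`|ω_β(p₀)| ≥ p₀/2`" (p.19 L113; indeed `|ω_β(p₀)| ≥ |p₀|/2`, from the two halves of (5.15)).
[cite: Salmhofer1998, §5.4 (p.19 L113)] -/
theorem abs_div_two_le_abs_omegaStep {β : ℝ} (hβ : 0 < β) (p₀ : ℝ) :
    |p₀| / 2 ≤ |omegaStep β p₀| := by
  have h1 := abs_omegaStep_sub_le hβ p₀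
  have h2 := pi_div_le_abs_omegaStep hβ p₀
  have h3 : |p₀| ≤ |omegaStep β p₀| + |omegaStep β p₀ - p₀| := by
    calc |p₀| = |omegaStep β p₀ - (omegaStep β p₀ - p₀)| := by ring_nf
      _ ≤ |omegaStep β p₀| + |omegaStep β p₀ - p₀| := abs_sub _ _
  linarith

/-! ### (5.17): the kernel `𝒞_t(x,y)` and its `t`-derivative -/

/-- (5.17) rewritten: `𝒞_t(x,y) = χ₁(((x² + y²)/ε₀²) e^{2t})/(ix - y)` (`ε_t = ε₀e^{-t}`).
[cite: Salmhofer1998, §5.4 (5.17) (p.19 L119–124)] -/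
theorem covC_eq {χ₁ : ℝ → ℝ} {eps0 : ℝ} (h0 : eps0 ≠ 0) (t x y : ℝ) :
    covC χ₁ eps0 t x y =
      ((χ₁ ((x ^ 2 + y ^ 2) / eps0 ^ 2 * Real.exp (2 * t)) : ℝ) : ℂ) /
        (Complex.I * (x : ℂ) - (y : ℂ)) := by
  unfold covC
  rw [epsT_inv_sq_mul h0]

/-- (5.17) as an identity of functions of `t`. [cite: Salmhofer1998, §5.4 (5.17) (p.19 L119–124)] -/
theorem covC_fun_eq {χ₁ : ℝ → ℝ} {eps0 : ℝ} (h0 : eps0 ≠ 0) (x y : ℝ) :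
    (fun t : ℝ => covC χ₁ eps0 t x y) = fun t : ℝ =>
      ((χ₁ ((x ^ 2 + y ^ 2) / eps0 ^ 2 * Real.exp (2 * t)) : ℝ) : ℂ) /
        (Complex.I * (x : ℂ) - (y : ℂ)) := by
  funext t; exact covC_eq h0 t x y

/-- `|ix - y|² = x² + y²` for real `x, y`. [cite: Salmhofer1998, §5.4 (5.17) (p.19 L119–124)] -/
theorem normSq_I_mul_sub (x y : ℝ) : ‖Complex.I * (x : ℂ) - (y : ℂ)‖ ^ 2 = x ^ 2 + y ^ 2 := by
  have h : Complex.I * (x : ℂ) - (y : ℂ) = ((-y : ℝ) : ℂ) + ((x : ℝ) : ℂ) * Complex.I := by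
    push_cast; ring
  rw [h, ← Complex.normSq_eq_norm_sq, Complex.normSq_add_mul_I]
  ring

/-- `(x² + y²) = -(ix - y)(ix + y)`, i.e. `(x² + y²)/(ix - y) = -(ix + y)` for `(x,y) ≠ 0`.
[cite: Salmhofer1998, §5.5 (p.20 L80–82)] -/
theorem sq_add_sq_div_eq {x y : ℝ} (h : Complex.I * (x : ℂ) - (y : ℂ) ≠ 0) :
    (((x ^ 2 + y ^ 2 : ℝ)) : ℂ) / (Complex.I * (x : ℂ) - (y : ℂ)) = -(Complex.I * (x : ℂ) + (y : ℂ)) := by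
  rw [div_eq_iff h]
  push_cast
  linear_combination ((x : ℂ) ^ 2) * Complex.I_mul_I

/-- `𝒞_t(x,y)` is `C^∞` in `t` ("`C_t` is … `C^∞` in `t`", Lemma 4). [cite: Salmhofer1998, Lemma 4 (p.19 L132–133)] -/
theorem contDiff_covC {χ₁ : ℝ → ℝ} (hχ : IsCutoff χ₁) {eps0 : ℝ} (h0 : 0 < eps0) (x y : ℝ) :
    ContDiff ℝ ((⊤ : ℕ∞) : WithTop ℕ∞) fun t : ℝ => covC χ₁ eps0 t x y := by
  rw [covC_fun_eq h0.ne']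
  exact contDiff_cutoffComp hχ (by positivity) _

/-- **"By cCdef, `𝒞̇_t(x,y) = -(2/ε_t²)(ix + y) χ₁'((x² + y²)/ε_t²)`"** (p.20 L80–82; also L4–6 in the proof
of Lemma 4). [cite: Salmhofer1998, Lemma 5 proof (p.20 L80–82); Lemma 4 proof (p.20 L4–6)] -/
theorem covCDot_eq {χ₁ : ℝ → ℝ} (hχ : IsCutoff χ₁) {eps0 : ℝ} (h0 : 0 < eps0) (t x y : ℝ) :
    covCDot χ₁ eps0 t x y =
      -(2 / (epsT eps0 t) ^ 2 : ℝ) * (Complex.I * (x : ℂ) + (y : ℂ)) *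
        ((deriv χ₁ ((x ^ 2 + y ^ 2) / (epsT eps0 t) ^ 2) : ℝ) : ℂ) := by
  unfold covCDot
  rw [covC_fun_eq h0.ne']
  set c : ℂ := Complex.I * (x : ℂ) - (y : ℂ) with hc
  set A : ℝ := (x ^ 2 + y ^ 2) / eps0 ^ 2 with hA
  have hεt := epsT_pos h0 t
  have harg : A * Real.exp (2 * t) = (x ^ 2 + y ^ 2) / (epsT eps0 t) ^ 2 := by
    rw [hA, ← epsT_inv_sq_mul h0.ne']; field_simp
  rcases eq_or_ne c 0 with hc0 | hc0
  · -- `x = y = 0`: both sides vanish (`χ₁(·)/0 = 0` and the factor `ix + y = 0`)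
    have hxy : x ^ 2 + y ^ 2 = 0 := by rw [← normSq_I_mul_sub, ← hc, hc0]; simp
    have hx : x = 0 := by nlinarith [sq_nonneg x, sq_nonneg y]
    have hy : y = 0 := by nlinarith [sq_nonneg x, sq_nonneg y]
    have : (fun s : ℝ => ((χ₁ (A * Real.exp (2 * s)) : ℝ) : ℂ) / c) = fun _ => (0 : ℂ) := by
      funext s; rw [hc0, div_zero]
    rw [this, deriv_const, hx, hy]
    simp
  · have hApos : 0 < A := by
      rw [hA]
      have : 0 < x ^ 2 + y ^ 2 := by
        rw [← normSq_I_mul_sub, ← hc]; exact pow_pos (norm_pos_iff.mpr hc0) 2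
      positivity
    rw [(hasDerivAt_cutoffComp hχ hApos c t).deriv, harg, div_eq_iff hc0, hc]
    have hεne : ((epsT eps0 t : ℝ) : ℂ) ≠ 0 := by exact_mod_cast hεt.ne'
    push_cast
    field_simp
    linear_combination (((deriv χ₁ ((x ^ 2 + y ^ 2) / epsT eps0 t ^ 2) : ℝ) : ℂ) * (x : ℂ) ^ 2) *
      Complex.I_mul_I

/-- The indicator `1(√(x² + y²) ≤ ε_t)`, i.e. `1(|ix - y| ≤ ε_t)`, as a real number. (Proof device; the
indicator of Lemma 4's first display.) [cite: Salmhofer1998, Lemma 4 (5.18) (p.19 L138–145)] -/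
theorem shellC_nonneg (eps0 t x y : ℝ) :
    0 ≤ (if ‖Complex.I * (x : ℂ) - (y : ℂ)‖ ≤ epsT eps0 t then (1 : ℝ) else 0) := by
  split_ifs <;> norm_num

/-- `𝒞_t(x,y) = 0` off the support `|ix - y| ≤ ε_t` (`χ₁ = 0` on `[1,∞)`). [cite: Salmhofer1998, Lemma 4 proof (p.20 L2–3)] -/
theorem covC_eq_zero_of_lt {χ₁ : ℝ → ℝ} (hχ : IsCutoff χ₁) {eps0 : ℝ} (h0 : 0 < eps0) {t x y : ℝ}
    (h : epsT eps0 t < ‖Complex.I * (x : ℂ) - (y : ℂ)‖) : covC χ₁ eps0 t x y = 0 := by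
  unfold covC
  have hεt := epsT_pos h0 t
  have h1 : 1 ≤ (epsT eps0 t)⁻¹ ^ 2 * (x ^ 2 + y ^ 2) := by
    rw [← normSq_I_mul_sub, ← mul_pow, ← div_eq_inv_mul]
    have : 1 < ‖Complex.I * (x : ℂ) - (y : ℂ)‖ / epsT eps0 t := by
      rw [lt_div_iff₀ hεt]; linarith
    nlinarith
  rw [hχ.eq_zero _ h1]
  simp

/-- **The `α = 0` case of (5.18) for the kernel, `B₀ = 4`**: `|𝒞̇_t(x,y)| ≤ 4ε_t⁻¹ 1(|ix - y| ≤ ε_t)` ("since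
`Ċ_t(p) = -2ε_t⁻²(iω_β + E)χ₁'(…)` and `‖χ₁'‖_∞ ≤ 2`, `|Ċ_t(p)| ≤ (4/ε_t) 1(|iω_β(p₀) - E(𝐩)| ≤ ε_t)`. Thus
`B₀ = 4`"). [cite: Salmhofer1998, Lemma 4 (5.18) (p.19 L138–145), proof p.20 L4–9] -/
theorem norm_covCDot_le {χ₁ : ℝ → ℝ} (hχ : IsCutoff χ₁) {eps0 : ℝ} (h0 : 0 < eps0) (t x y : ℝ) :
    ‖covCDot χ₁ eps0 t x y‖ ≤
      4 * (epsT eps0 t)⁻¹ * (if ‖Complex.I * (x : ℂ) - (y : ℂ)‖ ≤ epsT eps0 t then (1 : ℝ) else 0) := by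
  have hεt := epsT_pos h0 t
  set r := ‖Complex.I * (x : ℂ) - (y : ℂ)‖ with hr
  have hr0 : 0 ≤ r := norm_nonneg _
  have hr2 : r ^ 2 = x ^ 2 + y ^ 2 := normSq_I_mul_sub x y
  have hplus : ‖Complex.I * (x : ℂ) + (y : ℂ)‖ = r := by
    have h1 : ‖Complex.I * (x : ℂ) + (y : ℂ)‖ ^ 2 = x ^ 2 + y ^ 2 := by
      have h : Complex.I * (x : ℂ) + (y : ℂ) = ((y : ℝ) : ℂ) + ((x : ℝ) : ℂ) * Complex.I := by
        ring
      rw [h, ← Complex.normSq_eq_norm_sq, Complex.normSq_add_mul_I]; ring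
    exact (pow_left_inj₀ (norm_nonneg _) hr0 two_ne_zero).mp (h1.trans hr2.symm)
  rw [covCDot_eq hχ h0, norm_mul, norm_mul, norm_neg, Complex.norm_real, Complex.norm_real,
    Real.norm_eq_abs, Real.norm_eq_abs, hplus, abs_of_pos (by positivity : 0 < 2 / (epsT eps0 t) ^ 2)]
  set z := (x ^ 2 + y ^ 2) / (epsT eps0 t) ^ 2 with hz
  have hzr : z = (r / epsT eps0 t) ^ 2 := by rw [hz, ← hr2, div_pow]
  split_ifs with hle
  · -- on the support: `|χ₁'(z)| ≤ 2` (or `r = 0`)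
    rw [mul_one]
    rcases hr0.eq_or_lt with hrz | hrpos
    · rw [← hrz]; simp only [mul_zero, zero_mul]; positivity
    · have hzpos : 0 < z := by rw [hzr]; positivity
      have hd : |deriv χ₁ z| ≤ 2 := hχ.deriv_bound z hzpos
      calc 2 / epsT eps0 t ^ 2 * r * |deriv χ₁ z| ≤ 2 / epsT eps0 t ^ 2 * epsT eps0 t * 2 := by
            gcongr
        _ = 4 * (epsT eps0 t)⁻¹ := by field_simp; ring
  · -- off the support: `z > 1`, `χ₁'(z) = 0`
    push Not at hle
    have hz1 : 1 < z := by
      rw [hzr]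
      have : 1 < r / epsT eps0 t := by rw [lt_div_iff₀ hεt]; linarith
      nlinarith
    rw [hχ.deriv_eq_zero_of_one_lt hz1]
    simp

/-- The support refinement of (5.18): `1(|ix - y| ≤ ε_t) ≤ 1(|x| ≤ ε_t) 1(|y| ≤ ε_t)`.
[cite: Salmhofer1998, Lemma 4 (5.18) second line (p.19 L142–145)] -/
theorem shell_indicator_le (eps0 t x y : ℝ) :
    (if ‖Complex.I * (x : ℂ) - (y : ℂ)‖ ≤ epsT eps0 t then (1 : ℝ) else 0) ≤
      (if |x| ≤ epsT eps0 t then (1 : ℝ) else 0) * (if |y| ≤ epsT eps0 t then (1 : ℝ) else 0) := by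
  have hx : |x| ≤ ‖Complex.I * (x : ℂ) - (y : ℂ)‖ := by
    have := Complex.abs_im_le_norm (Complex.I * (x : ℂ) - (y : ℂ))
    simpa using this
  have hy : |y| ≤ ‖Complex.I * (x : ℂ) - (y : ℂ)‖ := by
    have := Complex.abs_re_le_norm (Complex.I * (x : ℂ) - (y : ℂ))
    simpa using this
  split_ifs with h h1 h2 <;> first | (exfalso; linarith) | norm_num

/-! ### Lemma 4, scalar part: the thermodynamic-limit propagator `D̂_t(p) = 𝒞_t(ω_β(p₀), E(𝐩))` -/

/-- `D̂_t(p)` is `C^∞` in `t` (Lemma 4, first sentence). [cite: Salmhofer1998, Lemma 4 (p.19 L132–133)] -/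
theorem contDiff_cutoffCovInf (M : ModelData d) {χ₁ : ℝ → ℝ} (hχ : IsCutoff χ₁) (h0 : 0 < M.eps0)
    (β p₀ : ℝ) (p : Mom d) :
    ContDiff ℝ ((⊤ : ℕ∞) : WithTop ℕ∞) fun t : ℝ => cutoffCovInf M χ₁ β t p₀ p := by
  unfold cutoffCovInf
  exact contDiff_covC hχ h0 _ _

/-- `D̂_t(p)` is bounded: `|D̂_t(p)| ≤ β/π` (`0 ≤ χ₁ ≤ 1` and `|iω_β(p₀) - E| ≥ |ω_β(p₀)| ≥ π/β`; Lemma 4,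
first sentence, with the bound made explicit). [cite: Salmhofer1998, Lemma 4 (p.19 L132–133); (5.15) (p.19 L107–113)] -/
theorem norm_cutoffCovInf_le (M : ModelData d) {χ₁ : ℝ → ℝ} (hχ : IsCutoff χ₁) {β : ℝ} (hβ : 0 < β)
    (t p₀ : ℝ) (p : Mom d) : ‖cutoffCovInf M χ₁ β t p₀ p‖ ≤ β / Real.pi := by
  unfold cutoffCovInf covC
  set x := omegaStep β p₀ with hx
  set y := M.E p with hy
  have hπ := Real.pi_pos
  have hxge : Real.pi / β ≤ |x| := pi_div_le_abs_omegaStep hβ p₀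
  have hc : Real.pi / β ≤ ‖Complex.I * (x : ℂ) - (y : ℂ)‖ := by
    refine le_trans hxge ?_
    have := Complex.abs_im_le_norm (Complex.I * (x : ℂ) - (y : ℂ))
    simpa using this
  have hcpos : 0 < ‖Complex.I * (x : ℂ) - (y : ℂ)‖ := lt_of_lt_of_le (by positivity) hc
  rw [norm_div, Complex.norm_real, Real.norm_eq_abs, div_le_iff₀ hcpos]
  have harg : 0 ≤ (epsT M.eps0 t)⁻¹ ^ 2 * (x ^ 2 + y ^ 2) := by positivity
  obtain ⟨h1, h2⟩ := hχ.mem_Icc _ harg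
  rw [abs_of_nonneg h1]
  calc χ₁ ((epsT M.eps0 t)⁻¹ ^ 2 * (x ^ 2 + y ^ 2)) ≤ 1 := h2
    _ = β / Real.pi * (Real.pi / β) := by field_simp
    _ ≤ β / Real.pi * ‖Complex.I * (x : ℂ) - (y : ℂ)‖ := by gcongr

/-- **`D̂_t ≡ 0` for `t > log(βε₀/π)`** (Lemma 4: "If `t > log(βε₀/π)`, then `C_t(p) = 0` for all
`p ∈ ℝ × 𝓑`"; proof: "for `C_t(p)` to be nonzero, `|ω_β(p₀)| ≤ ε_t` must hold", and `|ω_β| ≥ π/β`).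
[cite: Salmhofer1998, Lemma 4 (p.19 L133–135), proof p.20 L2–3] -/
theorem cutoffCovInf_eq_zero_of_log_lt (M : ModelData d) {χ₁ : ℝ → ℝ} (hχ : IsCutoff χ₁)
    (h0 : 0 < M.eps0) {β : ℝ} (hβ : 0 < β) {t : ℝ} (ht : Real.log (β * M.eps0 / Real.pi) < t)
    (p₀ : ℝ) (p : Mom d) : cutoffCovInf M χ₁ β t p₀ p = 0 := by
  unfold cutoffCovInf
  apply covC_eq_zero_of_lt hχ h0
  have hπ := Real.pi_pos
  have hxge : Real.pi / β ≤ |omegaStep β p₀| := pi_div_le_abs_omegaStep hβ p₀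
  have hc : Real.pi / β ≤ ‖Complex.I * (omegaStep β p₀ : ℂ) - (M.E p : ℂ)‖ := by
    refine le_trans hxge ?_
    have := Complex.abs_im_le_norm (Complex.I * (omegaStep β p₀ : ℂ) - (M.E p : ℂ))
    simpa using this
  refine lt_of_lt_of_le ?_ hc
  -- `ε₀ e^{-t} < π/β` iff `βε₀/π < e^t` iff `log(βε₀/π) < t`
  unfold epsT
  have hpos : 0 < β * M.eps0 / Real.pi := by positivity
  rw [Real.log_lt_iff_lt_exp hpos] at ht
  rw [Real.exp_neg, lt_div_iff₀ hβ]
  have hexp := Real.exp_pos t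
  rw [div_lt_iff₀ hπ] at ht
  calc M.eps0 * (Real.exp t)⁻¹ * β = β * M.eps0 / Real.exp t := by field_simp
    _ < Real.pi := by rw [div_lt_iff₀ hexp]; linarith

/-- The `t`-derivative of `D̂_t(p)` is `𝒞̇_t(ω_β(p₀), E(𝐩))` (definitional). [cite: Salmhofer1998, §5.4 (p.20 L4–6)] -/
theorem deriv_cutoffCovInf (M : ModelData d) (χ₁ : ℝ → ℝ) (β t p₀ : ℝ) (p : Mom d) :
    deriv (fun s : ℝ => cutoffCovInf M χ₁ β s p₀ p) t = covCDot χ₁ M.eps0 t (omegaStep β p₀) (M.E p) :=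
  rfl

/-- **Lemma 4, (5.18) at `α = 0` with `B₀ = 4`**: `|Ḋ̂_t(p)| ≤ 4ε_t⁻¹ 1(|iω_β(p₀) - E(𝐩)| ≤ ε_t)`.
[cite: Salmhofer1998, Lemma 4 (5.18) (p.19 L138–145), proof p.20 L4–9] -/
theorem norm_deriv_cutoffCovInf_le (M : ModelData d) {χ₁ : ℝ → ℝ} (hχ : IsCutoff χ₁) (h0 : 0 < M.eps0)
    (β t p₀ : ℝ) (p : Mom d) :
    ‖deriv (fun s : ℝ => cutoffCovInf M χ₁ β s p₀ p) t‖ ≤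
      4 * (epsT M.eps0 t)⁻¹ *
        (if ‖Complex.I * (omegaStep β p₀ : ℂ) - (M.E p : ℂ)‖ ≤ epsT M.eps0 t then (1 : ℝ) else 0) := by
  rw [deriv_cutoffCovInf]
  exact norm_covCDot_le hχ h0 t _ _

/-- **Lemma 4, (5.18) at `α = 0`, second line**:
`|Ḋ̂_t(p)| ≤ 4ε_t⁻¹ 1(|ω_β(p₀)| ≤ ε_t) 1(|E(𝐩)| ≤ ε_t)`. [cite: Salmhofer1998, Lemma 4 (5.18) (p.19 L142–145)] -/
theorem norm_deriv_cutoffCovInf_le' (M : ModelData d) {χ₁ : ℝ → ℝ} (hχ : IsCutoff χ₁) (h0 : 0 < M.eps0)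
    (β t p₀ : ℝ) (p : Mom d) :
    ‖deriv (fun s : ℝ => cutoffCovInf M χ₁ β s p₀ p) t‖ ≤
      4 * (epsT M.eps0 t)⁻¹ * ((if |omegaStep β p₀| ≤ epsT M.eps0 t then (1 : ℝ) else 0) *
        (if |M.E p| ≤ epsT M.eps0 t then (1 : ℝ) else 0)) := by
  refine le_trans (norm_deriv_cutoffCovInf_le M hχ h0 β t p₀ p) ?_
  have hεt := epsT_pos h0 t
  gcongr
  exact shell_indicator_le M.eps0 t (omegaStep β p₀) (M.E p)

end Salmhofer1998

end Literature.MathematicalPhysics.QuantumLattice.FermiRG
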